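import Summits.HubbardSuperconductivity.HubbardSuperconductivity.Theses.LogColdTorus
import Summits.HubbardSuperconductivity.HubbardSuperconductivity.Theorems.BalabanIRBirEveryGroundState
import Summits.HubbardSuperconductivity.HubbardSuperconductivity.Theorems.LogColdTorusAverageToEveryBlockTrace
import Summits.HubbardSuperconductivity.HubbardSuperconductivity.Theorems.LogColdTorusAverageToEveryHalfFilling
import Summits.HubbardSuperconductivity.HubbardSuperconductivity.Theorems.LogColdTorusAverageToEveryRegimes
import HarnessLib

/-!
# Route `LogColdTorus`, crux `AverageToEvery` (item `stmt-HubbardSuperconductivity-10519`, shared with route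
`AbelianDuality`): the crux on the route's fillings is a COROLLARY of the sibling crux
`BalabanIR.BirEveryGroundState`, and its exact open content is the doped transfer law

Helpers (`--supports`) for the crux
`Summit.HubbardSuperconductivity.HubbardSuperconductivity.Theses.LogColdTorus.AverageToEvery`.
Plan-level facts, kernel-certified (D-0014: the lead reports on the plan with evidence):

* `averageToEvery_Ioo_of_birEveryGroundState` — **`BalabanIR.BirEveryGroundState`
  (item stmt-HubbardSuperconductivity-2083) implies `AverageToEvery` restricted to the dopings
  `δ ∈ (0, 1/2)`** — the only fillings at which route `LogColdTorus` ever applies its crux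
  (`LogColdDWaveOrder` produces `δ ∈ (0, 1/2)`). The sibling's hypothesis is WEAKER (its threshold
  `L₀` may depend on the coupling `U`, and it is stated with the ground projector `P`:
  `c L⁴ · re tr P ≤ re tr (P Δ_d† Δ_d)`), its conclusion is word for word the same; the block
  ground-state average of this crux is `(tr P)⁻¹ tr (P Δ_d† Δ_d)` by the landed dictionary
  `hubbardTorus_blockGroundStateFunctional_eq_traceAverage`, and `tr P = dim E₀(U, L) ∈ ℕ`
  (`trace_projMatrix_map_eq_finrank`), so the uniform block bound gives the projector bound.
* `averageToEvery_imp_Ioo` — bookkeeping: the restricted statement IS the crux under the extra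
  binder `δ ∈ (0, 1/2)`.
* `hubbardSuperconductivity_of_logColdOrder_of_birEveryGroundState` — hence the route's deciding implication with its
  crux REPLACED by the sibling crux: `LogColdDWaveOrder → LogColdToGround → BirEveryGroundState →
  HubbardSuperconductivity` (same two lines as `LogColdTorus.closes`). One open every-ground-state
  item (stmt-2083) serves both routes; stmt-10519 as typed is stronger only at fillings
  (`δ ∉ (0, 1/2)`) the assembly never visits.
* `averageToEvery_iff_dopedTransfer` — **the crux is EQUIVALENT to its transfer form on the doped
  range `0 < |δ| < 1` alone**: the slices `δ = 0` (`averageToEvery_halfFilling`, Lieb's Theorem 2)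
  and `|δ| ≥ 1` (`averageToEvery_of_one_le_abs`) are theorems, and on the doped range the crux and
  the transfer law are interchangeable (`averageToEvery_iff_transfer` pointwise in `δ`). This is the
  exact (not merely sufficient) residual a conjecture item may carry.

Tasaki (2020) §2.1; Scalapino, Phys. Rep. 250 (1995) 329, §2 eq. (2.4); Lieb, PRL 62 (1989) 1201.
Folklore bookkeeping over landed theorems; no definition and no named fact is introduced.
-/

noncomputable section

-- `dupNamespace`: the summit and the problem are both named `HubbardSuperconductivity` (layout D-0022)
set_option linter.dupNamespace false

namespace Summit.HubbardSuperconductivity.HubbardSuperconductivity.Theorems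

open Matrix Finset Filter
open Literature.Probability.LatticeModels Literature.MathematicalPhysics.QuantumLattice
open scoped ComplexOrder Matrix Classical

/-! ## The crux on `δ ∈ (0, 1/2)` from the sibling crux `BirEveryGroundState` -/

/-- **`BirEveryGroundState` ⇒ `AverageToEvery` on the route's fillings `δ ∈ (0, 1/2)`.** Assume the
sibling crux `BalabanIR.BirEveryGroundState`. Let `δ ∈ (0, 1/2)`, `0 < U₁ < U₂`, `c > 0`, `L₀`, and
suppose the window hypothesis of `AverageToEvery`: for every `U ∈ (U₁, U₂)` and every even `L ≥ L₀`
the block ground-state average of `Δ_d† Δ_d` in the `(2⌊(1-δ)L²/2⌋, S^z = 0)` sector is `≥ c L⁴`.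
At each such `(U, L)` the block average equals `(tr P)⁻¹ re tr (P Δ_d† Δ_d)` for the ground
projector `P` of the sector ground eigenspace (`hubbardTorus_blockGroundStateFunctional_eq_traceAverage`,
`⌊(1-δ)L²/2⌋ ≤ L²`), and `tr P = dim E₀ ∈ ℕ` (`trace_projMatrix_map_eq_finrank`; `dim E₀ = 0` would
make the average `0 < c L⁴`, so `dim E₀ ≥ 1`); multiplying through gives the sibling's projector
bound `c L⁴ re tr P ≤ re tr (P Δ_d† Δ_d)` with the SAME threshold `L₀` at every `U`, and the
sibling crux returns a coupling of the window at which every admissible normalised sector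
ground-state sequence has `d_{x²-y²}` pair-field long-range order — the conclusion of
`AverageToEvery`, word for word. Tasaki (2020) §2.1; Scalapino, Phys. Rep. 250 (1995) 329, §2.
[folklore] -/
theorem averageToEvery_Ioo_of_birEveryGroundState
    (hBir : Summit.HubbardSuperconductivity.HubbardSuperconductivity.Theses.BalabanIR.BirEveryGroundState) :
    ∀ δ : ℝ, δ ∈ Set.Ioo (0:ℝ) (1/2) → ∀ (U₁ U₂ c : ℝ) (L₀ : ℕ), 0 < U₁ → U₁ < U₂ → 0 < c →
      (∀ U ∈ Set.Ioo U₁ U₂, ∀ (L : ℕ) [NeZero L], L₀ ≤ L → Even L →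
        let p : Finset (Orb (FermionTorus 2 L)) → Prop := fun s =>
          s.card = 2 * ⌊(1 - δ) * (L : ℝ) ^ 2 / 2⌋₊ ∧
            2 * (s.filter fun i => (ofLex i).2 = 0).card = 2 * ⌊(1 - δ) * (L : ℝ) ^ 2 / 2⌋₊
        c * (L : ℝ) ^ 4 ≤ (((hubbardTorus 2 L 1 U).toBlock p p).groundStateFunctional
          (((pairField dWaveFormFactor L)ᴴ * pairField dWaveFormFactor L).toBlock p p)).re) →
      ∃ U ∈ Set.Ioo U₁ U₂, ∀ (N : ℕ → ℕ) (ψ : ∀ L, Fock (Orb (FermionTorus 2 L))),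
        (∀ L, Even L → N L = 2 * ⌊(1 - δ) * (L : ℝ) ^ 2 / 2⌋₊ ∧ star (ψ L) ⬝ᵥ ψ L = 1 ∧
          IsGroundStateInSector (hubbardTorus 2 L 1 U) (N L) 0 (ψ L)) →
        HasLongRangeOrder (fun k => halfOpenBox 2 (2 * k))
          (fun k => torusPullback (pairFieldCorr dWaveFormFactor ψ) (2 * k)) := by
  intro δ hδ U₁ U₂ c L₀ hU₁ hU₁₂ hc hyp
  refine hBir δ U₁ U₂ c hδ hU₁ hU₁₂ hc fun U hU => ⟨L₀, fun L _ hL hLe => ?_⟩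
  dsimp only
  -- abbreviations for the objects of side `L` at the coupling `U`
  set Y : Matrix (Finset (Orb (FermionTorus 2 L))) (Finset (Orb (FermionTorus 2 L))) ℂ :=
    (pairField dWaveFormFactor L)ᴴ * pairField dWaveFormFactor L with hY
  set E₀ : Submodule ℂ (Fock (Orb (FermionTorus 2 L))) :=
    szSector (Λ := FermionTorus 2 L) (2 * ⌊(1 - δ) * (L : ℝ) ^ 2 / 2⌋₊) 0 ⊓
      Module.End.eigenspace (Matrix.toLin' (hubbardTorus 2 L 1 U))
        ((((hubbardTorus 2 L 1 U).minEnergyOn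
          (szSector (Λ := FermionTorus 2 L) (2 * ⌊(1 - δ) * (L : ℝ) ^ 2 / 2⌋₊) 0)) : ℝ) : ℂ)
    with hE₀
  set P : Matrix (Finset (Orb (FermionTorus 2 L))) (Finset (Orb (FermionTorus 2 L))) ℂ :=
    projMatrix (E₀.map (Fock.toEuclidean (ι := Orb (FermionTorus 2 L)) :
      Fock (Orb (FermionTorus 2 L)) →ₗ[ℂ] EuclideanSpace ℂ (Finset (Orb (FermionTorus 2 L)))))
    with hP
  -- the block hypothesis at `(U, L)`, in projector form
  have hn : ⌊(1 - δ) * (L : ℝ) ^ 2 / 2⌋₊ ≤ L ^ 2 :=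
    NoGo.floor_pairNumber_le δ (by linarith [hδ.1]) L
  have h0 := hyp U hU L hL hLe
  dsimp only at h0
  rw [hubbardTorus_blockGroundStateFunctional_eq_traceAverage L 1 U _ hn] at h0
  -- `h0 : c L⁴ ≤ re ((tr P)⁻¹ * tr (P Y))`
  change c * (L : ℝ) ^ 4 ≤ ((P.trace)⁻¹ * (P * Y).trace).re at h0
  change c * (L : ℝ) ^ 4 * P.trace.re ≤ (P * Y).trace.re
  -- `tr P = dim E₀`
  have htr : P.trace = (Module.finrank ℂ E₀ : ℂ) := by
    rw [hP, map_toEuclidean_eq]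
    exact trace_projMatrix_map_eq_finrank E₀
  set d : ℕ := Module.finrank ℂ E₀ with hd
  rw [htr, ← Complex.ofReal_natCast, ← Complex.ofReal_inv, Complex.re_ofReal_mul] at h0
  rw [htr, Complex.natCast_re]
  -- `d = 0` is impossible (the average would vanish), so `d > 0` and we multiply through
  have hL1 : (1 : ℝ) ≤ (L : ℝ) := by exact_mod_cast NeZero.one_le
  have hcL : 0 < c * (L : ℝ) ^ 4 := by positivity
  have hdpos : (0 : ℝ) < (d : ℝ) := by
    rcases Nat.eq_zero_or_pos d with hd0 | hdp
    · exfalso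
      rw [hd0, Nat.cast_zero, _root_.inv_zero, zero_mul] at h0
      exact absurd h0 (not_le.mpr hcL)
    · exact_mod_cast hdp
  have h1 : c * (L : ℝ) ^ 4 ≤ (P * Y).trace.re / (d : ℝ) := by
    rwa [div_eq_inv_mul]
  exact (le_div_iff₀ hdpos).1 h1

/-- **Bookkeeping: `averageToEvery_Ioo_of_birEveryGroundState` concludes the RESTRICTION of the
crux to `δ ∈ (0, 1/2)`.** `AverageToEvery` with its leading `∀ δ` guarded by `δ ∈ (0, 1/2)` is, word
for word, that conclusion (one-term proof). [folklore] -/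
theorem averageToEvery_imp_Ioo
    (h : Summit.HubbardSuperconductivity.HubbardSuperconductivity.Theses.LogColdTorus.AverageToEvery) :
    ∀ δ : ℝ, δ ∈ Set.Ioo (0:ℝ) (1/2) → ∀ (U₁ U₂ c : ℝ) (L₀ : ℕ), 0 < U₁ → U₁ < U₂ → 0 < c →
      (∀ U ∈ Set.Ioo U₁ U₂, ∀ (L : ℕ) [NeZero L], L₀ ≤ L → Even L →
        let p : Finset (Orb (FermionTorus 2 L)) → Prop := fun s =>
          s.card = 2 * ⌊(1 - δ) * (L : ℝ) ^ 2 / 2⌋₊ ∧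
            2 * (s.filter fun i => (ofLex i).2 = 0).card = 2 * ⌊(1 - δ) * (L : ℝ) ^ 2 / 2⌋₊
        c * (L : ℝ) ^ 4 ≤ (((hubbardTorus 2 L 1 U).toBlock p p).groundStateFunctional
          (((pairField dWaveFormFactor L)ᴴ * pairField dWaveFormFactor L).toBlock p p)).re) →
      ∃ U ∈ Set.Ioo U₁ U₂, ∀ (N : ℕ → ℕ) (ψ : ∀ L, Fock (Orb (FermionTorus 2 L))),
        (∀ L, Even L → N L = 2 * ⌊(1 - δ) * (L : ℝ) ^ 2 / 2⌋₊ ∧ star (ψ L) ⬝ᵥ ψ L = 1 ∧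
          IsGroundStateInSector (hubbardTorus 2 L 1 U) (N L) 0 (ψ L)) →
        HasLongRangeOrder (fun k => halfOpenBox 2 (2 * k))
          (fun k => torusPullback (pairFieldCorr dWaveFormFactor ψ) (2 * k)) :=
  fun δ _ => h δ

/-- **The route's deciding implication with its crux replaced by the sibling crux.** Exactly the two
lines of `LogColdTorus.closes`, with `AverageToEvery` supplied on `δ ∈ (0, 1/2)` by
`averageToEvery_Ioo_of_birEveryGroundState`: `LogColdDWaveOrder` produces `δ ∈ (0, 1/2)`, a window
and log-cold order; `LogColdToGround` descends it to the sector ground-state average (uniform `L₁`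
on the window); the sibling crux `BalabanIR.BirEveryGroundState` upgrades it to every ground state
at one coupling; this is the summit `HubbardSuperconductivity` at `(U, δ)`. (Plan-level certificate:
the route may cite stmt-2083 in place of stmt-10519.) [folklore] -/
theorem hubbardSuperconductivity_of_logColdOrder_of_birEveryGroundState :
    Summit.HubbardSuperconductivity.HubbardSuperconductivity.Theses.LogColdTorus.LogColdDWaveOrder →
    Summit.HubbardSuperconductivity.HubbardSuperconductivity.Theses.LogColdTorus.LogColdToGround →
    Summit.HubbardSuperconductivity.HubbardSuperconductivity.Theses.BalabanIR.BirEveryGroundState →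
    HubbardSuperconductivity := by
  intro h1 h2 hBir
  obtain ⟨δ, hδ, U₁, U₂, hU₁, hU₁₂, κ₀, c, hκ₀, hc, h⟩ := h1
  obtain ⟨c', hc', L₁, hhub⟩ := h2 δ U₁ U₂ κ₀ c hU₁ hU₁₂ hκ₀ hc h
  obtain ⟨U, hU, hLRO⟩ :=
    averageToEvery_Ioo_of_birEveryGroundState hBir δ hδ U₁ U₂ c' L₁ hU₁ hU₁₂ hc' hhub
  unfold HubbardSuperconductivity Literature.Hubbard.DWaveSuperconductivityHubbard
  exact ⟨U, lt_trans hU₁ hU.1, δ, hδ, hLRO⟩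

/-! ## The exact open content: the transfer law on the doped range `0 < |δ| < 1` -/

/-- **`AverageToEvery` ⇔ the DOPED transfer law.** The crux is equivalent to: for all `δ` with
`0 < |δ| < 1` and all `(U₁, U₂, c, L₀)` with `0 < U₁ < U₂`, `0 < c`, the window hypothesis (block
ground-state average of `Δ_d† Δ_d` at least `c L⁴` for all `U ∈ (U₁, U₂)` and all even `L ≥ L₀`)
yields a coupling `U ∈ (U₁, U₂)`, a constant `a > 0` and a side `L₁` with `a L⁴ ≤ re ⟨ψ, Δ_d† Δ_d ψ⟩`
for every normalised `(2⌊(1-δ)L²/2⌋, S^z = 0)`-sector ground state at every even `L ≥ L₁`.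
(⇒: `averageToEvery_iff_transfer`, forgetting the undoped fillings. ⇐: by cases on the filling —
`|δ| ≥ 1` is the theorem `averageToEvery_of_one_le_abs`, `δ = 0` is the theorem
`averageToEvery_halfFilling` (Lieb's Theorem 2), and on `0 < |δ| < 1` the transfer bound at the
produced coupling gives the long-range order of every admissible sequence by
`hasLRO_of_forall_groundState_bound`.) So the crux's open content is EXACTLY the doped transfer law —
window-relative, hence (like the crux) refutable only through a datum where the window hypothesis
holds. Scalapino, Phys. Rep. 250 (1995) 329, §2 eq. (2.4); Lieb, PRL 62 (1989) 1201. [folklore] -/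
theorem averageToEvery_iff_dopedTransfer :
    Summit.HubbardSuperconductivity.HubbardSuperconductivity.Theses.LogColdTorus.AverageToEvery ↔
    (∀ (δ U₁ U₂ c : ℝ) (L₀ : ℕ), 0 < |δ| → |δ| < 1 → 0 < U₁ → U₁ < U₂ → 0 < c →
      (∀ U ∈ Set.Ioo U₁ U₂, ∀ (L : ℕ) [NeZero L], L₀ ≤ L → Even L →
        c * (L : ℝ) ^ 4 ≤ (((hubbardTorus 2 L 1 U).toBlock
          (fun s : Finset (Orb (FermionTorus 2 L)) => s.card = 2 * ⌊(1 - δ) * (L : ℝ) ^ 2 / 2⌋₊ ∧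
            2 * (s.filter fun i => (ofLex i).2 = 0).card = 2 * ⌊(1 - δ) * (L : ℝ) ^ 2 / 2⌋₊)
          (fun s : Finset (Orb (FermionTorus 2 L)) => s.card = 2 * ⌊(1 - δ) * (L : ℝ) ^ 2 / 2⌋₊ ∧
            2 * (s.filter fun i => (ofLex i).2 = 0).card = 2 * ⌊(1 - δ) * (L : ℝ) ^ 2 / 2⌋₊)).groundStateFunctional
          ((((pairField dWaveFormFactor L)ᴴ * pairField dWaveFormFactor L)).toBlock
          (fun s : Finset (Orb (FermionTorus 2 L)) => s.card = 2 * ⌊(1 - δ) * (L : ℝ) ^ 2 / 2⌋₊ ∧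
            2 * (s.filter fun i => (ofLex i).2 = 0).card = 2 * ⌊(1 - δ) * (L : ℝ) ^ 2 / 2⌋₊)
          (fun s : Finset (Orb (FermionTorus 2 L)) => s.card = 2 * ⌊(1 - δ) * (L : ℝ) ^ 2 / 2⌋₊ ∧
            2 * (s.filter fun i => (ofLex i).2 = 0).card = 2 * ⌊(1 - δ) * (L : ℝ) ^ 2 / 2⌋₊))).re) →
      ∃ U ∈ Set.Ioo U₁ U₂, ∃ a : ℝ, 0 < a ∧ ∃ L₁ : ℕ, ∀ (L : ℕ) [NeZero L], L₁ ≤ L → Even L →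
        ∀ ψ : Fock (Orb (FermionTorus 2 L)),
          IsGroundStateInSector (hubbardTorus 2 L 1 U) (2 * ⌊(1 - δ) * (L : ℝ) ^ 2 / 2⌋₊) 0 ψ →
          star ψ ⬝ᵥ ψ = 1 →
          a * (L : ℝ) ^ 4 ≤
            (star ψ ⬝ᵥ ((pairField dWaveFormFactor L)ᴴ * pairField dWaveFormFactor L) *ᵥ ψ).re) := by
  constructor
  · intro h δ U₁ U₂ c L₀ _ _ hU₁ hU₁₂ hc hyp
    exact averageToEvery_iff_transfer.1 h δ U₁ U₂ c L₀ hU₁ hU₁₂ hc hyp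
  · intro hdt δ U₁ U₂ c L₀ hU₁ hU₁₂ hc hyp
    by_cases h1 : 1 ≤ |δ|
    · -- `|δ| ≥ 1`: empty or one-dimensional sectors (theorem)
      exact averageToEvery_of_one_le_abs δ h1 U₁ U₂ c L₀ hU₁ hU₁₂ hc hyp
    · by_cases h0 : δ = 0
      · -- half filling: Lieb's Theorem 2 (theorem)
        subst h0
        exact averageToEvery_halfFilling U₁ U₂ c L₀ hU₁ hU₁₂ hc hyp
      · -- the doped range: the transfer law at the produced coupling
        obtain ⟨U, hU, a, ha, L₁, hL₁⟩ :=
          hdt δ U₁ U₂ c L₀ (abs_pos.mpr h0) (not_le.mp h1) hU₁ hU₁₂ hc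
            (fun U hU L _ hL hLe => hyp U hU L hL hLe)
        exact ⟨U, hU, fun N ψ hadm =>
          hasLRO_of_forall_groundState_bound U δ a ha L₁
            (fun L _ hL hLe φ hgs hunit => hL₁ L hL hLe φ hgs hunit) N ψ hadm⟩

end Summit.HubbardSuperconductivity.HubbardSuperconductivity.Theorems

end
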